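import Summits.ResolutionOfSingularities.ResolutionOfSingularities.Theorems.PurelyInseparableDim4ScopeBlindSubstDomain
import Summits.ResolutionOfSingularities.ResolutionOfSingularities.Theorems.PurelyInseparableDim4ScopeBlindNormLeaf
import Mathlib.RingTheory.Localization.Away.Basic
import HarnessLib

/-!
# UNIFORM-OUT ON A LAURENT GRAPH `x_m = −c/a` — the «rational-graph leaf» of the ∀K column ‖ K

Census cell «res-dim4-pi» (D-0157 DOOR 2), seat res-dim4-p-8 g3, for res-dim4-typ-3g9's FCert v2.  res-dim4-eng-w2 g2's class (1)
(bus 2026-08-29 01:00Z): 49 of the 162 uniform-out loci of the (2,2) ∀K residue are LAURENT GRAPHS `{x_T = 0, a·x_m + c = 0}` with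
`a` a monomial (more generally any polynomial) in the other coordinates — `x₂x₄² + x₃² + x₃x₄`, `x₂x₃ + x₄²`, `x₂x₃ + 1`, … — which no
POLYNOMIAL substitution retracts onto.  The substitution `x_m ↦ −c/a` lands in the domain `K[x][1/a]`; `…ScopeBlindSubstDomain`
(`not_inCoordinateScope_translate_of_substHom`) does the rest.

* §1 over a field `K`: `laurentσ / laurentφ T m a c : K[x] →+* Localization.Away a` (`x_T ↦ 0`, `x_m ↦ −c/a`, `xᵢ ↦ xᵢ`), the
  identities `laurentφ_monomial` (a monomial free of `x_T, x_m` goes to its image), `alg_a_mul_σm` (`a·σ_m + c = 0`),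
  `laurentφ_comp_kill` (`φ` factors through `x_T ↦ 0`), and **`not_inCoordinateScope_translate_of_laurent`**: if `a ≠ 0`,
  `φ a = a`, `φ c = c`, `c + γ·a ≠ 0` for every scalar `γ`, and for every `0 < |α| < q` SOME `N, g` with
  `(a^N · D^{(α)}G)(x_T ↦ 0) = (g · (a·x_m + c))(x_T ↦ 0)` (a division certificate), plus the usual witness `(D^{(α₀)}G)(x_T ↦ 0) ≠ 0`,
  then at EVERY `b` with `b_T = 0`, `a(b) ≠ 0`, `a(b)·b_m + c(b) = 0` the translate `G(x + b)` is OUT of coordinate scope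
  (point `ev = IsLocalization.Away.lift (eval b)`); child form `not_inCoordinateScope_step_of_laurent`;
* §2 the `𝔽_p`-side Bool certificate **`laurentBlindB p G T m aL cL cert α₀`** on term lists (`cert : (Fin 4 → ℕ) → ℕ × Terms 4 k`
  supplies `(N, g)` per Hasse index; all checks by `equivB` after killing `x_T`) and its soundness over EVERY field of
  characteristic `p` along every `f : k →+* K`: **`not_inCoordinateScope_step_map_of_laurentBlindB`** (+ the `ZMod p` entry);
* §3 acceptance: eng-w2's torus specimen `x₁·(x₂x₃ + 1)`-type chart by `decide` (`laurentBlindB_torusSpec`, `torusSpec_children_blind`).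

Honest scope: a sufficient criterion for ONE child of OUR frame to be out of coordinate scope at the points of a Laurent graph with
`a(b) ≠ 0` (the sub-locus `a = 0` is eng-w2's «empty or coordinate line», closed by flat leaves); nothing here proves F4-C(2,2)
or resolution of singularities in dim ≥ 4 / char p.  [OURS · counted 0 · kernel work, weaker than expert review.]
bears_on: LADDER-RESOLUTION:D157-DOOR2 (res-dim4-pi · ∀K column · Laurent leaf).  Supports stmt-ResolutionOfSingularities-16155 (helper).
-/

set_option linter.dupNamespace false -- mandated namespace of this single-conjunct summit

noncomputable section

open MvPolynomial Finset
open scoped BigOperators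

namespace Summit.ResolutionOfSingularities.ResolutionOfSingularities.Theorems.PIDim4

namespace ScopeBlind

open Literature.AlgebraicGeometry.Resolution
open Literature.AlgebraicGeometry.Resolution.CentreBlowup
open Literature.AlgebraicGeometry.Resolution.Hauser2010
open StepKit ScopeCover ScopeDynamics

/-! ## §1 The Laurent substitution over a field `K` -/

section OverK

variable {K : Type} [Field K]

/-- the substitution `x_T ↦ 0`, `x_m ↦ −c/a`, `xᵢ ↦ xᵢ`, with values in `K[x][1/a]`. [OURS · instrument] -/
def laurentσ (T : Finset (Fin 4)) (m : Fin 4) (a c : MvPolynomial (Fin 4) K) : Fin 4 → Localization.Away a := fun i =>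
  if i ∈ T then 0
  else if i = m then -(algebraMap (MvPolynomial (Fin 4) K) (Localization.Away a) c) * IsLocalization.Away.invSelf a
  else algebraMap (MvPolynomial (Fin 4) K) (Localization.Away a) (X i)

/-- the Laurent substitution as a ring map `K[x] →+* K[x][1/a]`. [OURS · instrument] -/
def laurentφ (T : Finset (Fin 4)) (m : Fin 4) (a c : MvPolynomial (Fin 4) K) :
    MvPolynomial (Fin 4) K →+* Localization.Away a :=
  MvPolynomial.eval₂Hom ((algebraMap (MvPolynomial (Fin 4) K) (Localization.Away a)).comp MvPolynomial.C) (laurentσ T m a c)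

variable (T : Finset (Fin 4)) (m : Fin 4) (a c : MvPolynomial (Fin 4) K)

/-- `φ` on scalars. [folklore] -/
theorem laurentφ_C (γ : K) :
    laurentφ T m a c (C γ) = algebraMap (MvPolynomial (Fin 4) K) (Localization.Away a) (C γ) := by
  rw [laurentφ, MvPolynomial.eval₂Hom_C, RingHom.comp_apply]

/-- `φ` on variables. [folklore] -/
theorem laurentφ_X (i : Fin 4) : laurentφ T m a c (X i) = laurentσ T m a c i := by
  rw [laurentφ, MvPolynomial.eval₂Hom_X']

/-- `φ (x_i) = 0` for `i ∈ T`. [folklore] -/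
theorem laurentφ_X_of_mem {i : Fin 4} (hi : i ∈ T) : laurentφ T m a c (X i) = 0 := by
  rw [laurentφ_X, laurentσ, if_pos hi]

/-- `φ (x_i) = x_i` for `i ∉ T`, `i ≠ m`. [folklore] -/
theorem laurentφ_X_of_free {i : Fin 4} (hi : i ∉ T) (him : i ≠ m) :
    laurentφ T m a c (X i) = algebraMap (MvPolynomial (Fin 4) K) (Localization.Away a) (X i) := by
  rw [laurentφ_X, laurentσ, if_neg hi, if_neg him]

/-- `φ (x_m) = −c/a` (`m ∉ T`). [folklore] -/
theorem laurentφ_X_m (hmT : m ∉ T) :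
    laurentφ T m a c (X m) =
      -(algebraMap (MvPolynomial (Fin 4) K) (Localization.Away a) c) * IsLocalization.Away.invSelf a := by
  rw [laurentφ_X, laurentσ, if_neg hmT, if_pos rfl]

/-- **`a · φ(x_m) + c = 0`** in `K[x][1/a]`. [folklore] -/
theorem alg_a_mul_σm (hmT : m ∉ T) :
    algebraMap (MvPolynomial (Fin 4) K) (Localization.Away a) a * laurentφ T m a c (X m) +
      algebraMap (MvPolynomial (Fin 4) K) (Localization.Away a) c = 0 := by
  rw [laurentφ_X_m T m a c hmT, mul_comm, mul_assoc, neg_mul,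
    mul_comm (IsLocalization.Away.invSelf a), IsLocalization.Away.mul_invSelf, mul_one, neg_add_cancel]

/-- a monomial free of `x_T` and `x_m` goes to its image. [folklore] -/
theorem laurentφ_monomial (d : Fin 4 →₀ ℕ) (r : K) (hd : ∀ i : Fin 4, i ∈ T ∨ i = m → d i = 0) :
    laurentφ T m a c (monomial d r) = algebraMap (MvPolynomial (Fin 4) K) (Localization.Away a) (monomial d r) := by
  rw [laurentφ, MvPolynomial.eval₂Hom_monomial, RingHom.comp_apply, MvPolynomial.monomial_eq, map_mul, map_finsuppProd]
  congr 1
  refine Finsupp.prod_congr fun i hi => ?_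
  have hdi : d i ≠ 0 := Finsupp.mem_support_iff.mp hi
  have hiT : i ∉ T := fun h => hdi (hd i (Or.inl h))
  have him : i ≠ m := fun h => hdi (hd i (Or.inr h))
  rw [map_pow, laurentσ, if_neg hiT, if_neg him]

/-- `φ` factors through `x_T ↦ 0`. [folklore] -/
theorem laurentφ_kill (P : MvPolynomial (Fin 4) K) :
    laurentφ T m a c (MvPolynomial.aeval (R := K) (fun i : Fin 4 => if i ∈ T then (0 : MvPolynomial (Fin 4) K) else X i) P) =
      laurentφ T m a c P := by
  have h : (laurentφ T m a c).comp
      (MvPolynomial.aeval (R := K) (fun i : Fin 4 => if i ∈ T then (0 : MvPolynomial (Fin 4) K) else X i)).toRingHom =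
      laurentφ T m a c := by
    refine MvPolynomial.ringHom_ext (fun γ => ?_) (fun i => ?_)
    · simp
    · simp only [RingHom.comp_apply, AlgHom.toRingHom_eq_coe, RingHom.coe_coe, MvPolynomial.aeval_X]
      by_cases hi : i ∈ T
      · rw [if_pos hi, map_zero, laurentφ_X_of_mem T m a c hi]
      · rw [if_neg hi]
  exact DFunLike.congr_fun h P

/-- the structure map `K[x] → K[x][1/a]` is injective for `a ≠ 0`. [folklore] -/
theorem alg_injective (ha : a ≠ 0) :
    Function.Injective (algebraMap (MvPolynomial (Fin 4) K) (Localization.Away a)) :=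
  IsLocalization.injective (Localization.Away a) (powers_le_nonZeroDivisors_of_noZeroDivisors ha)

/-- **UNIFORM-OUT ON A LAURENT GRAPH.**  Hypotheses: `m ∉ T`; `a ≠ 0`; `φ a = a`, `φ c = c` (i.e. `a, c` free of `x_T, x_m`);
`c + γ·a ≠ 0` for every scalar `γ`; for every `0 < |α| < q` a division certificate `(a^N · D^{(α)}G)(x_T ↦ 0) =
(g · (a x_m + c))(x_T ↦ 0)`; a witness `(D^{(α₀)}G)(x_T ↦ 0) ≠ 0`, `0 < |α₀| < q`.  Conclusion: at every `b` with `b_T = 0`,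
`a(b) ≠ 0`, `a(b)·b_m + c(b) = 0`, the translate `G(x + b)` is OUT of coordinate scope. OURS.
[cite: AtiyahMacdonald1969, Ch. 3 (rings of fractions; Prop. 3.11)] -/
theorem not_inCoordinateScope_translate_of_laurent {q : ℕ} (G : MvPolynomial (Fin 4) K) (hmT : m ∉ T) (ha : a ≠ 0)
    (haφ : laurentφ T m a c a = algebraMap (MvPolynomial (Fin 4) K) (Localization.Away a) a)
    (hcφ : laurentφ T m a c c = algebraMap (MvPolynomial (Fin 4) K) (Localization.Away a) c)
    (hca : ∀ γ : K, c + C γ * a ≠ 0)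
    (hJ : ∀ α : Fin 4 →₀ ℕ, 0 < α.degree → α.degree < q → ∃ (N : ℕ) (g : MvPolynomial (Fin 4) K),
      MvPolynomial.aeval (R := K) (fun i : Fin 4 => if i ∈ T then (0 : MvPolynomial (Fin 4) K) else X i)
          (a ^ N * hasseDeriv α G) =
        MvPolynomial.aeval (R := K) (fun i : Fin 4 => if i ∈ T then (0 : MvPolynomial (Fin 4) K) else X i)
          (g * (a * X m + c)))
    (α₀ : Fin 4 →₀ ℕ) (hα0 : 0 < α₀.degree) (hαq : α₀.degree < q)
    (hW : MvPolynomial.aeval (R := K) (fun i : Fin 4 => if i ∈ T then (0 : MvPolynomial (Fin 4) K) else X i)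
      (hasseDeriv α₀ G) ≠ 0)
    (b : Fin 4 → K) (hbT : ∀ i ∈ T, b i = 0) (hab : MvPolynomial.eval b a ≠ 0)
    (hZ : MvPolynomial.eval b a * b m + MvPolynomial.eval b c = 0) :
    ¬ InCoordinateScope q (PointBlowup.translate b G) := by
  classical
  haveI : IsDomain (Localization.Away a) := IsLocalization.Away.isDomain (S := Localization.Away a) ha
  have hinj := alg_injective a ha
  have hane : algebraMap (MvPolynomial (Fin 4) K) (Localization.Away a) a ≠ 0 := fun h =>
    ha (hinj (by rw [h, map_zero]))
  have hunit : IsUnit ((MvPolynomial.eval b) a) := isUnit_iff_ne_zero.mpr hab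
  -- the point of `K[x][1/a]` over `b`
  let ev : Localization.Away a →+* K := IsLocalization.Away.lift a (g := MvPolynomial.eval b) hunit
  have hev : ∀ P, ev (algebraMap (MvPolynomial (Fin 4) K) (Localization.Away a) P) = MvPolynomial.eval b P := fun P =>
    IsLocalization.Away.lift_eq a hunit P
  have hevinv : ev (IsLocalization.Away.invSelf a) = (MvPolynomial.eval b a)⁻¹ := by
    refine eq_inv_of_mul_eq_one_right ?_
    rw [← hev a, ← map_mul, IsLocalization.Away.mul_invSelf, map_one]
  refine not_inCoordinateScope_translate_of_substHom G (laurentφ T m a c) T (fun i hi => laurentφ_X_of_mem T m a c hi)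
    (fun i hiT γ h => ?_) (fun α h0 hq => ?_) α₀ hα0 hαq hW ev b (fun γ => ?_) (fun i => ?_)
  · -- `φ (x_i)` is not a scalar for `i ∉ T`
    rw [laurentφ_C] at h
    by_cases him : i = m
    · subst him
      rw [laurentφ_X_m T i a c hiT] at h
      have h2 : algebraMap (MvPolynomial (Fin 4) K) (Localization.Away a) a *
          (-(algebraMap (MvPolynomial (Fin 4) K) (Localization.Away a) c) * IsLocalization.Away.invSelf a) =
          algebraMap (MvPolynomial (Fin 4) K) (Localization.Away a) a *
            algebraMap (MvPolynomial (Fin 4) K) (Localization.Away a) (C γ) := by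
        rw [h]
      have h3 : algebraMap (MvPolynomial (Fin 4) K) (Localization.Away a) (C γ * a) =
          -(algebraMap (MvPolynomial (Fin 4) K) (Localization.Away a) c) := by
        rw [map_mul, mul_comm, ← h2, mul_left_comm, IsLocalization.Away.mul_invSelf, mul_one]
      have h4 : algebraMap (MvPolynomial (Fin 4) K) (Localization.Away a) (c + C γ * a) = 0 := by
        rw [map_add, h3, add_neg_cancel]
      exact hca γ (hinj (by rw [h4, map_zero]))
    · rw [laurentφ_X_of_free T m a c hiT him] at h
      exact X_ne_C i γ (hinj h)
  · -- the division certificate kills `D^{(α)}G`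
    obtain ⟨N, g, hNg⟩ := hJ α h0 hq
    have h1 := congrArg (laurentφ T m a c) hNg
    rw [laurentφ_kill, laurentφ_kill, map_mul, map_pow, haφ, map_mul, map_add, map_mul, haφ, hcφ,
      alg_a_mul_σm T m a c hmT, mul_zero] at h1
    exact (mul_eq_zero.mp h1).resolve_left (pow_ne_zero N hane)
  · -- `ev ∘ φ` fixes scalars
    rw [laurentφ_C, hev, MvPolynomial.eval_C]
  · -- `ev ∘ φ` sends `x_i ↦ b_i`
    by_cases hi : i ∈ T
    · rw [laurentφ_X_of_mem T m a c hi, map_zero, hbT i hi]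
    · by_cases him : i = m
      · subst him
        rw [laurentφ_X_m T i a c hi, map_mul, map_neg, hev, hevinv]
        field_simp
        linear_combination -hZ
      · rw [laurentφ_X_of_free T m a c hi him, hev, MvPolynomial.eval_X]

/-- **child form** (`q = p` the characteristic). OURS. [folklore] -/
theorem not_inCoordinateScope_step_of_laurent (p : ℕ) [Fact p.Prime] [CharP K p] [DecidableEq K] (S : Finset (Fin 4))
    (j : Fin 4) (s : State K) (hmT : m ∉ T) (ha : a ≠ 0)
    (haφ : laurentφ T m a c a = algebraMap (MvPolynomial (Fin 4) K) (Localization.Away a) a)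
    (hcφ : laurentφ T m a c c = algebraMap (MvPolynomial (Fin 4) K) (Localization.Away a) c)
    (hca : ∀ γ : K, c + C γ * a ≠ 0)
    (hJ : ∀ α : Fin 4 →₀ ℕ, 0 < α.degree → α.degree < p → ∃ (N : ℕ) (g : MvPolynomial (Fin 4) K),
      MvPolynomial.aeval (R := K) (fun i : Fin 4 => if i ∈ T then (0 : MvPolynomial (Fin 4) K) else X i)
          (a ^ N * hasseDeriv α (chartTransform p S j s.F)) =
        MvPolynomial.aeval (R := K) (fun i : Fin 4 => if i ∈ T then (0 : MvPolynomial (Fin 4) K) else X i)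
          (g * (a * X m + c)))
    (α₀ : Fin 4 →₀ ℕ) (hα0 : 0 < α₀.degree) (hαq : α₀.degree < p)
    (hW : MvPolynomial.aeval (R := K) (fun i : Fin 4 => if i ∈ T then (0 : MvPolynomial (Fin 4) K) else X i)
      (hasseDeriv α₀ (chartTransform p S j s.F)) ≠ 0)
    (b : Fin 4 → K) (hbT : ∀ i ∈ T, b i = 0) (hab : MvPolynomial.eval b a ≠ 0)
    (hZ : MvPolynomial.eval b a * b m + MvPolynomial.eval b c = 0) :
    ¬ InCoordinateScope p (CentreBlowup.step p S j b s).F := by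
  have hF : (CentreBlowup.step p S j b s).F = deletePthPowers p (PointBlowup.translate b (chartTransform p S j s.F)) := rfl
  unfold InCoordinateScope
  rw [hF, IsolatedBand.singLocusIdeal_deletePthPowers]
  exact not_inCoordinateScope_translate_of_laurent T m a c _ hmT ha haφ hcφ hca hJ α₀ hα0 hαq hW b hbT hab hZ

end OverK

/-! ## §2 The `𝔽_p`-side certificate and its soundness over every field -/

section Cert

variable {k : Type} [Field k] [DecidableEq k]

/-- every exponent of the list vanishes on `T` and at `m`. [OURS · instrument] -/
def freeOfB (T : Finset (Fin 4)) (m : Fin 4) (L : Terms 4 k) : Bool :=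
  L.all fun t => decide (∀ i : Fin 4, i ∈ T ∨ i = m → t.1 i = 0)

/-- kill `x_T` on a term list (drop the monomials touching `T`). [OURS · instrument] -/
def killTL (T : Finset (Fin 4)) (L : Terms 4 k) : Terms 4 k := L.filter fun t => ∀ i ∈ T, t.1 i = 0

/-- the variable `x_m` as a term list. [OURS · instrument] -/
def varL (m : Fin 4) : Terms 4 k := [((Pi.single m 1 : Fin 4 → ℕ), 1)]

/-- **`laurentBlindB p G T m aL cL cert α₀`** — the Laurent-leaf certificate: `m ∉ T`; `aL, cL` free of `x_T, x_m`; `aL ≢ 0`;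
some exponent has a non-zero coefficient in `cL` and coefficient `0` in `aL` (so `c ∉ K·a` over every field); for every Hasse
index `α ∈ idxLT p` the division identity `killT (aL^N · hasseL α G) ≡ killT (g · (aL·x_m + cL))` with `(N, g) := cert α`;
`0 < |α₀| < p` and `killT (hasseL α₀ G) ≢ 0`. [OURS · instrument] -/
def laurentBlindB (p : ℕ) (G : Terms 4 k) (T : Finset (Fin 4)) (m : Fin 4) (aL cL : Terms 4 k)
    (cert : (Fin 4 → ℕ) → ℕ × Terms 4 k) (α₀ : Fin 4 → ℕ) : Bool :=
  decide (m ∉ T) && freeOfB T m aL && freeOfB T m cL && !(StepKit.equivB aL []) &&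
    decide (∃ t ∈ cL, coeffAt cL t.1 ≠ 0 ∧ coeffAt aL t.1 = 0) &&
    ((idxLT p).all fun α =>
      StepKit.equivB (killTL T (mulL (powL aL (cert α).1) (hasseL α G)))
        (killTL T (mulL (cert α).2 (mulL aL (varL m) ++ cL)))) &&
    decide (0 < ∑ i, α₀ i ∧ ∑ i, α₀ i < p) &&
    !(StepKit.equivB (killTL T (hasseL α₀ G)) [])

omit [DecidableEq k] in
/-- `evalT (varL m) = X m`. [folklore] -/
theorem evalT_varL (m : Fin 4) : evalT (varL m : Terms 4 k) = X m := by
  rw [varL, evalT_cons, evalT_nil, add_zero]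
  show monomial (expo (Pi.single m 1 : Fin 4 → ℕ)) (1 : k) = X m
  rw [expo_pi_single, ← C_mul_X_eq_monomial, C_1, one_mul]

omit [DecidableEq k] in
/-- a `freeOfB` list, read in `K`, goes to its image under `φ`. [folklore] -/
theorem laurentφ_map_evalT_of_freeOfB {K : Type} [Field K] (f : k →+* K) (T : Finset (Fin 4)) (m : Fin 4)
    (a c : MvPolynomial (Fin 4) K) {L : Terms 4 k} (hL : freeOfB T m L = true) :
    laurentφ T m a c (MvPolynomial.map f (evalT L)) =
      algebraMap (MvPolynomial (Fin 4) K) (Localization.Away a) (MvPolynomial.map f (evalT L)) := by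
  induction L with
  | nil => simp
  | cons t L ih =>
    simp only [freeOfB, List.all_cons, Bool.and_eq_true, decide_eq_true_eq] at hL
    rw [evalT_cons, map_add, map_add, map_add, MvPolynomial.map_monomial, laurentφ_monomial T m a c _ _ (fun i hi => ?_),
      ih (by simpa [freeOfB] using hL.2)]
    rw [expo_apply]; exact hL.1 i hi

/-- **SOUNDNESS of `laurentBlindB` over EVERY field of characteristic `p`.**  If the certificate checks for a presented state `s`
over `k` (chart data `S, j`), then along every `f : k →+* K`, at EVERY `b ∈ K⁴` with `b_T = 0`, `a(b) ≠ 0` and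
`a(b)·b_m + c(b) = 0` (`a, c` = the lists `aL, cL` read in `K`), the child `CentreBlowup.step p S j b (s ⊗ K)` is OUT of coordinate
scope. OURS. [folklore] -/
theorem not_inCoordinateScope_step_map_of_laurentBlindB {p : ℕ} [Fact p.Prime] {s : SData 4 k} {S : Finset (Fin 4)} {j : Fin 4}
    {T : Finset (Fin 4)} {m : Fin 4} {aL cL : Terms 4 k} {cert : (Fin 4 → ℕ) → ℕ × Terms 4 k} {α₀ : Fin 4 → ℕ}
    (h : laurentBlindB p (chartL p S j s.L) T m aL cL cert α₀ = true)
    (K : Type) [Field K] [CharP K p] [DecidableEq K] (f : k →+* K) (b : Fin 4 → K) (hbT : ∀ i ∈ T, b i = 0)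
    (hab : MvPolynomial.eval b (MvPolynomial.map f (evalT aL)) ≠ 0)
    (hZ : MvPolynomial.eval b (MvPolynomial.map f (evalT aL)) * b m + MvPolynomial.eval b (MvPolynomial.map f (evalT cL)) = 0) :
    ¬ InCoordinateScope p
      (CentreBlowup.step p S j b (⟨MvPolynomial.map f s.toState.F, s.toState.r, s.toState.exc⟩ : State K)).F := by
  classical
  simp only [laurentBlindB, Bool.and_eq_true, decide_eq_true_eq, List.all_eq_true, Bool.not_eq_true'] at h
  obtain ⟨⟨⟨⟨⟨⟨⟨hmT, haF⟩, hcF⟩, ha0⟩, hca⟩, hJ⟩, hα₀⟩, hW⟩ := h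
  have hdeg : (expo α₀).degree = ∑ i, α₀ i := degree_expo α₀
  have hG : chartTransform p S j (MvPolynomial.map f s.toState.F) = MvPolynomial.map f (evalT (chartL p S j s.L)) := by
    rw [SData.toState_F, WinCertAllFields.chartTransform_map, chartTransform_evalT]
  have ha : MvPolynomial.map f (evalT aL) ≠ 0 := by
    rw [Ne, map_eq_zero_iff _ (MvPolynomial.map_injective f f.injective), evalT_eq_zero_iff, ha0]
    exact Bool.false_ne_true
  refine not_inCoordinateScope_step_of_laurent T m (MvPolynomial.map f (evalT aL)) (MvPolynomial.map f (evalT cL)) p S j _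
    hmT ha (laurentφ_map_evalT_of_freeOfB f T m _ _ haF) (laurentφ_map_evalT_of_freeOfB f T m _ _ hcF) (fun γ hγ => ?_)
    (fun α h0 hq => ?_) (expo α₀) (by rw [hdeg]; exact hα₀.1) (by rw [hdeg]; exact hα₀.2) ?_ b hbT hab hZ
  · -- `c + γ a ≠ 0`: read the coefficient at the distinguished exponent
    obtain ⟨t, _, hct, hat⟩ := hca
    have h1 := congrArg (coeff (expo t.1)) hγ
    rw [coeff_add, coeff_C_mul, coeff_zero, map_evalT, map_evalT, coeff_expo_evalT, coeff_expo_evalT,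
      coeffAt_map, coeffAt_map, hat, map_zero, mul_zero, add_zero, map_eq_zero_iff f f.injective] at h1
    exact hct h1
  · -- the division certificate for `α`
    refine ⟨(cert ⇑α).1, MvPolynomial.map f (evalT (cert ⇑α).2), ?_⟩
    have hz := hJ (⇑α) (mem_idxLT h0 hq)
    rw [← evalT_eq_iff_equivB, killTL, killTL, ← aeval_killT_evalT, ← aeval_killT_evalT, evalT_mulL, evalT_powL,
      evalT_mulL, evalT_append, evalT_mulL, evalT_varL, ← hasseDeriv_evalT, expo_coe] at hz
    have hzK := congrArg (MvPolynomial.map f) hz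
    rw [← aeval_killT_map, ← aeval_killT_map] at hzK
    change MvPolynomial.aeval (R := K) (fun i : Fin 4 => if i ∈ T then (0 : MvPolynomial (Fin 4) K) else X i)
        (MvPolynomial.map f (evalT aL) ^ (cert ⇑α).1 *
          hasseDeriv α (chartTransform p S j (MvPolynomial.map f s.toState.F))) =
      MvPolynomial.aeval (R := K) (fun i : Fin 4 => if i ∈ T then (0 : MvPolynomial (Fin 4) K) else X i)
        (MvPolynomial.map f (evalT (cert ⇑α).2) *
          (MvPolynomial.map f (evalT aL) * X m + MvPolynomial.map f (evalT cL)))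
    rw [hG, IsolationConverse.hasseDeriv_map]
    simpa only [map_mul, map_pow, map_add, MvPolynomial.map_X] using hzK
  · -- the witness
    change MvPolynomial.aeval (R := K) (fun i : Fin 4 => if i ∈ T then (0 : MvPolynomial (Fin 4) K) else X i)
      (hasseDeriv (expo α₀) (chartTransform p S j (MvPolynomial.map f s.toState.F))) ≠ 0
    rw [hG, IsolationConverse.hasseDeriv_map, aeval_killT_map, hasseDeriv_evalT, aeval_killT_evalT]
    intro h0
    apply (not_congr (evalT_eq_zero_iff _)).mpr (by rw [killTL] at hW; rw [hW]; exact Bool.false_ne_true)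
    exact (map_eq_zero_iff _ (MvPolynomial.map_injective f f.injective)).mp h0

/-- the `ZMod p` entry point: every field of characteristic `p`. OURS. [folklore] -/
theorem not_inCoordinateScope_step_cast_of_laurentBlindB {p : ℕ} [Fact p.Prime] {s : SData 4 (ZMod p)} {S : Finset (Fin 4)}
    {j : Fin 4} {T : Finset (Fin 4)} {m : Fin 4} {aL cL : Terms 4 (ZMod p)} {cert : (Fin 4 → ℕ) → ℕ × Terms 4 (ZMod p)}
    {α₀ : Fin 4 → ℕ} (h : laurentBlindB p (chartL p S j s.L) T m aL cL cert α₀ = true)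
    (K : Type) [Field K] [CharP K p] [DecidableEq K] (b : Fin 4 → K) (hbT : ∀ i ∈ T, b i = 0)
    (hab : MvPolynomial.eval b (MvPolynomial.map (ZMod.castHom (dvd_refl p) K) (evalT aL)) ≠ 0)
    (hZ : MvPolynomial.eval b (MvPolynomial.map (ZMod.castHom (dvd_refl p) K) (evalT aL)) * b m +
      MvPolynomial.eval b (MvPolynomial.map (ZMod.castHom (dvd_refl p) K) (evalT cL)) = 0) :
    ¬ InCoordinateScope p
      (CentreBlowup.step p S j b
        (⟨MvPolynomial.map (ZMod.castHom (dvd_refl p) K) s.toState.F, s.toState.r, s.toState.exc⟩ : State K)).F :=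
  not_inCoordinateScope_step_map_of_laurentBlindB h K (ZMod.castHom (dvd_refl p) K) b hbT hab hZ

end Cert

/-! ## §3 Acceptance: eng-w2's row S1a-22b28b7b5d (`x₃x₄² + x₂x₃² + x₁x₂³`, point centre, chart `x₄`) -/

section Acceptance

/-- the root `x₃x₄² + x₂x₃² + x₁x₂³` over `𝔽₂` (`r = 0`, `exc = ∅`).  Its `x₄`-chart child under the point blow-up is
`G = x₃x₄ + x₂x₃²x₄ + x₁x₂³x₄²`; on `E = {x₄ = 0}` the 2-fold locus is `{x₃ = 0}` (a flat, GENERIC-IN) together with the torus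
`{x₄ = 0, x₂x₃ + 1 = 0}` (eng-w2: «rational graph in x₂, den x₃», UNIFORM-OUT, no polynomial retraction). [OURS · specimen] -/
def torusSpec : SData 4 (ZMod 2) := ⟨[(![0, 0, 1, 2], 1), (![0, 1, 2, 0], 1), (![1, 3, 0, 0], 1)], ![0, 0, 0, 0], ∅⟩

/-- its division certificates: only `∂₄G = x₃ + x₂x₃² = x₃·(x₂x₃ + 1)` survives `x₄ ↦ 0` (`N = 0`, `g = x₃`). [OURS · specimen] -/
def torusCert : (Fin 4 → ℕ) → ℕ × Terms 4 (ZMod 2) := fun α =>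
  if α = ![0, 0, 0, 1] then (0, [(![0, 0, 1, 0], 1)]) else (0, [])

/-- the Laurent certificate of the torus (`T = {x₄}`, `m = x₂`, `a = x₃`, `c = 1`, `α₀ = e₄`) checks, by `decide`. [OURS · ‖ K] -/
theorem laurentBlindB_torusSpec :
    laurentBlindB 2 (chartL 2 Finset.univ 3 torusSpec.L) {3} 1 [(![0, 0, 1, 0], 1)] [(![0, 0, 0, 0], 1)] torusCert
      ![0, 0, 0, 1] = true := by
  decide

/-- **hence over EVERY field `K` of characteristic `2`, at EVERY point `b` of the exceptional divisor (`b₄ = 0`) with `b₃ ≠ 0` and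
`b₃·b₂ + 1 = 0`, the child of `x₃x₄² + x₂x₃² + x₁x₂³` (point blow-up, chart `x₄`) is OUT of coordinate scope.** [OURS · ‖ K] -/
theorem torusSpec_children_blind (K : Type) [Field K] [CharP K 2] [DecidableEq K] (b : Fin 4 → K) (hb4 : b 3 = 0)
    (hb3 : b 2 ≠ 0) (hZ : b 2 * b 1 + 1 = 0) :
    ¬ InCoordinateScope 2
      (CentreBlowup.step 2 Finset.univ 3 b
        (⟨MvPolynomial.map (ZMod.castHom (dvd_refl 2) K) torusSpec.toState.F, torusSpec.toState.r, torusSpec.toState.exc⟩ :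
          State K)).F := by
  refine not_inCoordinateScope_step_cast_of_laurentBlindB laurentBlindB_torusSpec K b
    (fun i hi => by rw [Finset.mem_singleton] at hi; rw [hi, hb4]) ?_ ?_
  · simpa [monomial_expo_eq, Fin.prod_univ_four] using hb3
  · simpa [monomial_expo_eq, Fin.prod_univ_four] using hZ

end Acceptance

end ScopeBlind

end Summit.ResolutionOfSingularities.ResolutionOfSingularities.Theorems.PIDim4

end
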